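import Summits.MatrixMultiplication.MatrixMultiplication.Theorems.SoloInformedTwistedMatchingsHeadline
import HarnessLib

/-!
# The bounded-exponent hypothesis of Theorem B″ is necessary for the method: cyclic hosts

Solo-informed seat (MatrixMultiplication), gen 101; sharpest-statement §2y(8), clause (d).
Theorem B″ (`realization_exp_card_ge_behrend`, `exists_expTwistedMatching_card_le`) bounds twisted
matchings in finite abelian groups of exponent dividing a FIXED `m` by `3|S|^{1-δ(m)}`. Here:
no such bound — with `δ` independent of the host — holds over all CYCLIC groups, already for the
untwisted predicate `x·y·z = 1`: a 3-AP-free `t ⊆ [0,N)` gives the matching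
`x_a = y_a = a`, `z_a = -2a` in `ℤ/2N` (`threeAPFree_cyclicMatching`), of size `r₃(N) ≥ N e^{-4√log N}`
(Behrend, Mathlib), and `N e^{-4√log N} > 3 (2N)^{1-δ}` for `log N ≥ (5/δ+1)²`
(`not_cyclic_matching_bound`). So the slice-rank route to ruling out translation schemes stops
EXACTLY at bounded exponent; hosts `ℤ/p^k` with `k → ∞` (and characteristic `→ ∞`) are untouched by
it — they are ruled out neither by B″ nor, as far as this seat knows, by anything in print.
References: Behrend (1946); CohnUmans2013 (arXiv:1207.6528) §5;
BlasiakChurchCohnGrochowNaslundSawinUmans2017 (arXiv:1605.06702) §1 (the same remark for `M₀ = 1`).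
-/

noncomputable section

open scoped BigOperators
open Finset

namespace Summit.MatrixMultiplication.MatrixMultiplication.Theorems.TwistedSliceRank

section Cyclic

/-- **A 3-AP-free set is a matching in a cyclic group**: for `t ⊆ [0,N)` without 3-term
arithmetic progressions, `x_a = y_a = a`, `z_a = -2a` in `ℤ/2N` satisfy
`x_a + y_b + z_c = 0 ⟺ a = b = c`. [folklore; cf. BCCGNSU17 §1] -/
theorem threeAPFree_cyclicMatching (N : ℕ) {t : Finset ℕ} (ht : ThreeAPFree (t : Set ℕ))
    (htN : t ⊆ Finset.range N) :
    ∃ (x y z : ↥t → Multiplicative (ZMod (2 * N))),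
      ∀ i j l : ↥t, (x i * y j * z l = 1) ↔ (i = j ∧ j = l) := by
  refine ⟨fun i => Multiplicative.ofAdd (((i : ℕ) : ZMod (2 * N))),
    fun i => Multiplicative.ofAdd (((i : ℕ) : ZMod (2 * N))),
    fun i => Multiplicative.ofAdd (-(2 * ((i : ℕ) : ZMod (2 * N)))), fun i j l => ?_⟩
  have hi : (i : ℕ) < N := Finset.mem_range.1 (htN i.2)
  have hj : (j : ℕ) < N := Finset.mem_range.1 (htN j.2)
  have hl : (l : ℕ) < N := Finset.mem_range.1 (htN l.2)
  rw [← ofAdd_add, ← ofAdd_add, ofAdd_eq_one]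
  constructor
  · intro h
    have hX : ((((i : ℕ) : ℤ) + ((j : ℕ) : ℤ) - 2 * ((l : ℕ) : ℤ) : ℤ) : ZMod (2 * N)) = 0 := by
      push_cast; rw [← h]; ring
    rw [ZMod.intCast_zmod_eq_zero_iff_dvd] at hX
    have hX0 : ((i : ℕ) : ℤ) + ((j : ℕ) : ℤ) - 2 * ((l : ℕ) : ℤ) = 0 :=
      Int.eq_zero_of_abs_lt_dvd hX (by rw [abs_lt]; push_cast; constructor <;> linarith)
    have h3 : (i : ℕ) + (j : ℕ) = (l : ℕ) + (l : ℕ) := by omega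
    have hil : (i : ℕ) = (l : ℕ) := ht i.2 l.2 j.2 h3
    have hjl : (j : ℕ) = (l : ℕ) := by omega
    exact ⟨Subtype.ext (hil.trans hjl.symm), Subtype.ext hjl⟩
  · rintro ⟨rfl, rfl⟩
    ring

/-- **No host-independent power saving over cyclic groups.** There is no `δ > 0` with: every
matching `x_i y_j z_l = 1 ⟺ i = j = l` in every cyclic group `ℤ/M` has `≤ 3 M^{1-δ}` elements.
(By `threeAPFree_cyclicMatching` and Behrend: `r₃(N) ≥ N e^{-4√(log N)} > 3(2N)^{1-δ}` once
`log N ≥ (5/δ + 1)²`.) Hence Theorem B″'s bounded-exponent hypothesis cannot be dropped from its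
slice-rank proof. [this work] -/
theorem not_cyclic_matching_bound :
    ¬ ∃ δ : ℝ, 0 < δ ∧ ∀ (M : ℕ) [NeZero M] (ι : Type) [Fintype ι]
        (x y z : ι → Multiplicative (ZMod M)),
        (∀ i j l : ι, (x i * y j * z l = 1) ↔ (i = j ∧ j = l)) →
        (Fintype.card ι : ℝ) ≤ 3 * (M : ℝ) ^ (1 - δ) := by
  rintro ⟨δ, hδ, hB⟩
  -- the parameter
  set t₀ : ℝ := 5 / δ + 1 with ht₀
  have ht₀0 : 0 < t₀ := by rw [ht₀]; positivity
  set N : ℕ := ⌈Real.exp (t₀ ^ 2)⌉₊ with hNdef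
  have hNexp : Real.exp (t₀ ^ 2) ≤ (N : ℝ) := Nat.le_ceil _
  have hN1 : (1 : ℝ) ≤ N := le_trans (by linarith [Real.add_one_le_exp (t₀ ^ 2), sq_nonneg t₀]) hNexp
  have hN0 : (0 : ℝ) < N := by linarith
  have hNpos : 0 < N := by exact_mod_cast hN0
  haveI : NeZero (2 * N) := ⟨by omega⟩
  -- the matching of size `r₃(N)` in `ℤ/2N`
  obtain ⟨t, htN, htcard, ht⟩ := rothNumberNat_spec N
  obtain ⟨x, y, z, hm⟩ := threeAPFree_cyclicMatching N ht htN
  have h1 := hB (2 * N) ↥t x y z hm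
  rw [Fintype.card_coe, htcard] at h1
  push_cast at h1
  -- upper bound: `N^δ e^{-4√log N} < 6`
  have hBeh : (N : ℝ) * Real.exp (-4 * Real.sqrt (Real.log N)) ≤ (rothNumberNat N : ℝ) :=
    Behrend.roth_lower_bound
  have h2 : (2 * (N : ℝ)) ^ (1 - δ) < 2 * (N : ℝ) ^ (1 - δ) := by
    rw [Real.mul_rpow (by norm_num) hN0.le]
    refine mul_lt_mul_of_pos_right ?_ (Real.rpow_pos_of_pos hN0 _)
    have h := Real.rpow_lt_rpow_of_exponent_lt (x := 2) (by norm_num) (show 1 - δ < 1 by linarith)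
    rwa [Real.rpow_one] at h
  have hsplit : (N : ℝ) = (N : ℝ) ^ (1 - δ) * (N : ℝ) ^ δ := by
    rw [← Real.rpow_add hN0, sub_add_cancel, Real.rpow_one]
  have hupper : (N : ℝ) ^ δ * Real.exp (-4 * Real.sqrt (Real.log N)) < 6 := by
    have h3 : (N : ℝ) ^ (1 - δ) * ((N : ℝ) ^ δ * Real.exp (-4 * Real.sqrt (Real.log N))) <
        (N : ℝ) ^ (1 - δ) * 6 := by
      calc (N : ℝ) ^ (1 - δ) * ((N : ℝ) ^ δ * Real.exp (-4 * Real.sqrt (Real.log N)))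
          = (N : ℝ) * Real.exp (-4 * Real.sqrt (Real.log N)) := by rw [← mul_assoc, ← hsplit]
        _ ≤ 3 * (2 * (N : ℝ)) ^ (1 - δ) := hBeh.trans h1
        _ < 3 * (2 * (N : ℝ) ^ (1 - δ)) := by linarith
        _ = (N : ℝ) ^ (1 - δ) * 6 := by ring
    exact lt_of_mul_lt_mul_left h3 (Real.rpow_nonneg hN0.le _)
  -- lower bound: `N^δ e^{-4√log N} = exp(δ log N - 4 √log N) ≥ exp 6 > 6`
  have hu : t₀ ^ 2 ≤ Real.log N := by
    have h := Real.log_le_log (Real.exp_pos _) hNexp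
    rwa [Real.log_exp] at h
  have hu0 : 0 ≤ Real.log N := le_trans (sq_nonneg _) hu
  set s : ℝ := Real.sqrt (Real.log N) with hs
  have hst : t₀ ≤ s := by
    rw [hs, ← Real.sqrt_sq ht₀0.le]
    exact Real.sqrt_le_sqrt hu
  have hs0 : 0 ≤ s := ht₀0.le.trans hst
  have hss : s ^ 2 = Real.log N := by rw [hs]; exact Real.sq_sqrt hu0
  have hδt : δ * t₀ = 5 + δ := by rw [ht₀]; field_simp
  have hδs : 5 + δ ≤ δ * s := by rw [← hδt]; exact mul_le_mul_of_nonneg_left hst hδ.le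
  have hexp6 : (6 : ℝ) ≤ δ * Real.log N - 4 * s := by
    have h4 : t₀ * (1 + δ) ≤ s * (δ * s - 4) :=
      mul_le_mul hst (by linarith) (by linarith) hs0
    have h5 : (6 : ℝ) ≤ t₀ * (1 + δ) := by
      have h6 : t₀ * (1 + δ) = 6 + 5 / δ + δ := by rw [ht₀]; field_simp; ring
      rw [h6]
      have : (0 : ℝ) < 5 / δ := by positivity
      linarith
    calc (6 : ℝ) ≤ s * (δ * s - 4) := h5.trans h4
      _ = δ * s ^ 2 - 4 * s := by ring
      _ = δ * Real.log N - 4 * s := by rw [hss]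
  have hlower : (6 : ℝ) < (N : ℝ) ^ δ * Real.exp (-4 * Real.sqrt (Real.log N)) := by
    rw [Real.rpow_def_of_pos hN0, ← Real.exp_add, ← hs]
    have h7 : (6 : ℝ) < Real.exp 6 := by linarith [Real.add_one_le_exp (6 : ℝ)]
    refine h7.trans_le (Real.exp_le_exp.2 ?_)
    linarith
  linarith

end Cyclic

end Summit.MatrixMultiplication.MatrixMultiplication.Theorems.TwistedSliceRank
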